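import Mathlib
import Summits.ResolutionOfSingularities.ResolutionOfSingularities.Theorems.HomologicalConductorPersistenceCyclicQuotientVertexIsolated
import Literature.RingTheory.CohomologyAnnihilator.Completion
import Literature.RingTheory.CohomologyAnnihilator.CompletionTheorem
import HarnessLib

/-!
# Rung S-2 `PersistenceSurface` (stmt-ResolutionOfSingularities-19970), stub C1 (`Sat₄`) — SHIFTED saturation through a
# COMMON COMPLETION: `ca(T) ⊆ ca^{a+d}(T)` whenever `T̂ ≃+* Ŝ` and `ca(S) ⊆ caᵃ(S)`; at every stage ANALYTICALLY
# isomorphic to the vertex of `k[u,v]^{(n;1,q)}`: `ca(T) ⊆ ca⁶(T)`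

[OURS · cell decomp-res · rung S-2; seat leafhand-res-homologicalconduct-15 gen 0]  Nothing here is a statement of the
manuscript under review (Hironaka 2017); AI-written, weaker than expert review.  DEF-FREE.

The stages of the tower are local rings which are toric only ANALYTICALLY (their COMPLETION is that of a cyclic
quotient), not as rings.  What the tree's completion machinery gives TODAY for such a stage is recorded here exactly:
[BahlekehHakimianSalarianTakahashi2015, Thm. 4.5] ascends with a SHIFT by the dimension (`caⁿ(R) ⊆ caⁿ⁺ᵈ(R̂) ∩ R`,
tree `le_caCompletion_comap_holds`) and descends level by level (`caCompletion_comap_le_holds`); `ca(Ŝ) = ca(S)·Ŝ` when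
`ca(S)` is `𝔪`-primary (`cohomologyAnnihilator_completion_eq_map`); `ca`, `caⁿ` are invariant under ring isomorphisms.

* `cohomologyAnnihilator_le_caAt_add_of_ringEquiv_completion` — `S`, `T` noetherian local of dimension `d` with
  isolated-singularity completions, `e : T̂ ≃+* Ŝ`, `ca(S)` `𝔪`-primary, `ca(S) ⊆ caᵃ(S)` ⇒ `ca(T) ⊆ ca^{a+d}(T)`;
* `maximalIdeal_pow_le_caAt_three_vertex` — for `U = k[u,v]^{(n;1,q)}` and its vertex `𝔪 ∋ uⁿ, vⁿ`: `𝔪ᴺ ⊆ ca³(U)` for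
  some `N` (`𝔪 ⊆ √(uⁿ, vⁿ)` by `…VertexIsolated.mem_of_constantCoeff_eq_zero`, and `uⁿ, vⁿ ∈ ca³(U)`), hence
  `exists_maximalIdeal_pow_le_cohomologyAnnihilator_atVertex` — `ca(S)` is `𝔪S`-primary for every localisation `S` of
  `U` at the vertex; `cohomologyAnnihilator_le_caAt_four_atVertex` — `caᵐ(S) = ca⁴(U)·S` (`m ≥ 4`), `ca(S) ⊆ ca⁴(S)`;
* `cohomologyAnnihilator_le_caAt_six_of_ringEquiv_completion_vertex` — **every noetherian local `T` of dimension `d`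
  whose completion is ring-isomorphic to `(U_𝔪)^` (both completions isolated singularities, `dim U_𝔪 = d`) has
  `ca(T) ⊆ ca^{4+d}(T)`**; for the surface stages (`d = 2`): `Sat₆`, not the stub's `Sat₄` — the loss `d` is BHST's
  shift, and removing it needs level-exact completion ascent (second syzygies over `Ŝ` as retracts of base changes of
  second syzygies over `S`: punctured-free retract + «a second syzygy is a retract of its double dual» + `Hom` base
  change), not in the tree.

References: A. Bahlekeh, E. Hakimian, S. Salarian, R. Takahashi, Q. J. Math. 67 (2016), Thm. 4.5
[`BahlekehHakimianSalarianTakahashi2015`]; S. B. Iyengar, R. Takahashi, IMRN 2016 [`IyengarTakahashi2014`] — through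
landed tree lemmas only.
-/

-- single-problem summit: the doubled namespace component `ResolutionOfSingularities` is forced
set_option linter.dupNamespace false

noncomputable section

open IsLocalRing MvPolynomial Literature.RingTheory.CohomologyAnnihilator
open Summit.ResolutionOfSingularities.ResolutionOfSingularities.Theorems.HomologicalConductor.PersistenceCyclicQuotientAllCharFree
open Summit.ResolutionOfSingularities.ResolutionOfSingularities.Theorems.HomologicalConductor.PersistenceCyclicQuotientCharFree
  (isNoetherianRing_degreeZero)
open Summit.ResolutionOfSingularities.ResolutionOfSingularities.Theorems.HomologicalConductor.PersistenceCyclicQuotientLocalVertex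
open Summit.ResolutionOfSingularities.ResolutionOfSingularities.Theorems.HomologicalConductor.PersistenceCyclicQuotientVertexIsolated
open Summit.ResolutionOfSingularities.ResolutionOfSingularities.Theorems.HomologicalConductor

universe u

namespace Summit.ResolutionOfSingularities.ResolutionOfSingularities.Theorems.HomologicalConductor.PersistenceSurfaceSaturationCommonCompletion

/-! ## Shifted saturation through a common completion -/

/-- **`ca(T) ⊆ ca^{a+d}(T)` through a common completion.**  `S`, `T` noetherian local rings of Krull dimension `d`
whose `𝔪`-adic completions are isolated singularities and ring-isomorphic (`e : T̂ ≃+* Ŝ`); `ca(S)` contains a power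
of `𝔪_S` and `ca(S) ⊆ caᵃ(S)`.  Then `ca(T) ⊆ ca^{a+d}(T)`:
`x ∈ caⁿ(T) ↦ x̂ ∈ caⁿ⁺ᵈ(T̂) ⊆ ca(T̂) ≅ ca(Ŝ) = ca(S)·Ŝ ⊆ caᵃ(S)·Ŝ ⊆ ca^{a+d}(Ŝ) ≅ ca^{a+d}(T̂)`, and
`ca^{a+d}(T̂) ∩ T ⊆ ca^{a+d}(T)`. [cite: BahlekehHakimianSalarianTakahashi2015, Thm. 4.5] -/
theorem cohomologyAnnihilator_le_caAt_add_of_ringEquiv_completion {S T : Type u} [CommRing S] [CommRing T]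
    [IsNoetherianRing S] [IsNoetherianRing T] [IsLocalRing S] [IsLocalRing T] {d a : ℕ}
    (hdS : ringKrullDim S = d) (hdT : ringKrullDim T = d)
    (hisoS : IsIsolatedSingularity (AdicCompletion (maximalIdeal S) S))
    (hisoT : IsIsolatedSingularity (AdicCompletion (maximalIdeal T) T))
    (e : AdicCompletion (maximalIdeal T) T ≃+* AdicCompletion (maximalIdeal S) S)
    (hprim : ∃ N : ℕ, maximalIdeal S ^ N ≤ cohomologyAnnihilator S)
    (hsat : cohomologyAnnihilator S ≤ cohomologyAnnihilatorOfDegree S a) :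
    cohomologyAnnihilator T ≤ cohomologyAnnihilatorOfDegree T (a + d) := by
  intro x hx
  obtain ⟨n, hn⟩ := mem_cohomologyAnnihilator_iff.mp hx
  -- ascent with shift
  have h1 := le_caCompletion_comap_holds T d hdT hisoT n hn
  rw [Ideal.mem_comap] at h1
  -- transport along `e` into `ca(Ŝ)`
  have h2 : e (algebraMap T (AdicCompletion (maximalIdeal T) T) x) ∈
      cohomologyAnnihilator (AdicCompletion (maximalIdeal S) S) :=
    mem_cohomologyAnnihilator_iff.mpr ⟨n + d, ringEquiv_apply_mem_cohomologyAnnihilatorOfDegree e h1⟩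
  -- `ca(Ŝ) = ca(S)·Ŝ ⊆ caᵃ(S)·Ŝ ⊆ ca^{a+d}(Ŝ)`
  have h3 : cohomologyAnnihilator (AdicCompletion (maximalIdeal S) S) ≤
      cohomologyAnnihilatorOfDegree (AdicCompletion (maximalIdeal S) S) (a + d) := by
    rw [cohomologyAnnihilator_completion_eq_map caCompletion_comap_le_holds le_caCompletion_comap_holds hdS hisoS
      hprim]
    refine (Ideal.map_mono hsat).trans ?_
    rw [Ideal.map_le_iff_le_comap]
    exact le_caCompletion_comap_holds S d hdS hisoS a
  -- back along `e⁻¹` and descend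
  have h4 : algebraMap T (AdicCompletion (maximalIdeal T) T) x ∈
      cohomologyAnnihilatorOfDegree (AdicCompletion (maximalIdeal T) T) (a + d) := by
    have h := ringEquiv_apply_mem_cohomologyAnnihilatorOfDegree e.symm (h3 h2)
    rwa [RingEquiv.symm_apply_apply] at h
  exact caCompletion_comap_le_holds T (a + d) (Ideal.mem_comap.mpr h4)

/-! ## The vertex of the cyclic quotient: `ca` is `𝔪`-primary, at level `3` -/

variable {k : Type u} [Field k] {n : ℕ} [NeZero n] {q : ℕ} (U : Subalgebra k (MvPolynomial (Fin 2) k))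
variable (hU : ∀ p, p ∈ U ↔ weightedHomogeneousComponent (![1, (q : ZMod n)] : Fin 2 → ZMod n) 0 p = p)

include hU in
/-- At the vertex `𝔪 ∋ uⁿ, vⁿ`, every element of `𝔪` has zero constant term (else `𝔪` would contain a non-zero
constant, a unit). [folklore] -/
theorem constantCoeff_eq_zero_of_mem_vertex (𝔪 : Ideal U) [𝔪.IsMaximal]
    (hu : (⟨(X 0 : MvPolynomial (Fin 2) k) ^ n, X_pow_mem U hU 0⟩ : U) ∈ 𝔪)
    (hv : (⟨(X 1 : MvPolynomial (Fin 2) k) ^ n, X_pow_mem U hU 1⟩ : U) ∈ 𝔪) (x : U) (hx : x ∈ 𝔪) :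
    constantCoeff (x : MvPolynomial (Fin 2) k) = 0 := by
  obtain ⟨c, hc⟩ : ∃ c : k, constantCoeff (x : MvPolynomial (Fin 2) k) = c := ⟨_, rfl⟩
  let xp : U := x - ⟨C c, C_mem U hU c⟩
  have hxp : constantCoeff (xp : MvPolynomial (Fin 2) k) = 0 := by
    simp only [xp, AddSubgroupClass.coe_sub, map_sub, constantCoeff_C, hc, sub_self]
  have hm : xp ∈ 𝔪 := mem_of_constantCoeff_eq_zero U hU 𝔪 hu hv xp hxp
  by_contra hc0
  rw [hc] at hc0
  have hCmem : (⟨C c, C_mem U hU c⟩ : U) ∈ 𝔪 := by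
    have : (⟨C c, C_mem U hU c⟩ : U) = x - xp := by simp [xp]
    rw [this]; exact 𝔪.sub_mem hx hm
  have hunit : IsUnit (⟨C c, C_mem U hU c⟩ : U) := by
    refine isUnit_iff_exists_inv.mpr ⟨⟨C c⁻¹, C_mem U hU c⁻¹⟩, Subtype.ext ?_⟩
    change C c * C c⁻¹ = (1 : MvPolynomial (Fin 2) k)
    rw [← C_mul, mul_inv_cancel₀ hc0, C_1]
  exact Ideal.IsMaximal.ne_top ‹𝔪.IsMaximal› (Ideal.eq_top_of_isUnit_mem _ hCmem hunit)

include hU in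
/-- **`𝔪ᴺ ⊆ ca³(U)` at the vertex.**  `𝔪 ⊆ √(uⁿ, vⁿ)` (every prime over `(uⁿ, vⁿ)` contains the elements of zero
constant term, `…VertexIsolated.mem_of_constantCoeff_eq_zero`), `𝔪` is finitely generated, and `uⁿ, vⁿ ∈ ca³(U)`.
[OURS · cell decomp-res] -/
theorem maximalIdeal_pow_le_caAt_three_vertex (hq : q.Coprime n) (𝔪 : Ideal U) [𝔪.IsMaximal]
    (hu : (⟨(X 0 : MvPolynomial (Fin 2) k) ^ n, X_pow_mem U hU 0⟩ : U) ∈ 𝔪)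
    (hv : (⟨(X 1 : MvPolynomial (Fin 2) k) ^ n, X_pow_mem U hU 1⟩ : U) ∈ 𝔪) :
    ∃ N : ℕ, 𝔪 ^ N ≤ cohomologyAnnihilatorOfDegree U 3 := by
  haveI : IsNoetherianRing U := isNoetherianRing_degreeZero (k := k) (n := n) q U hU
  let I : Ideal U := Ideal.span {(⟨(X 0 : MvPolynomial (Fin 2) k) ^ n, X_pow_mem U hU 0⟩ : U),
    (⟨(X 1 : MvPolynomial (Fin 2) k) ^ n, X_pow_mem U hU 1⟩ : U)}
  have hI : I ≤ cohomologyAnnihilatorOfDegree U 3 := by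
    rw [Ideal.span_le]
    rintro y hy
    rcases hy with rfl | hy
    · exact X_zero_pow_mem_caAt_three U hU hq
    · rw [Set.mem_singleton_iff] at hy; rw [hy]; exact X_one_pow_mem_caAt_three U hU hq
  have hrad : 𝔪 ≤ I.radical := by
    intro x hx
    rw [Ideal.radical_eq_sInf, Submodule.mem_sInf]
    rintro 𝔭 ⟨hIp, hp⟩
    haveI := hp
    have hup : (⟨(X 0 : MvPolynomial (Fin 2) k) ^ n, X_pow_mem U hU 0⟩ : U) ∈ 𝔭 :=
      hIp (Ideal.subset_span (by simp))
    have hvp : (⟨(X 1 : MvPolynomial (Fin 2) k) ^ n, X_pow_mem U hU 1⟩ : U) ∈ 𝔭 :=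
      hIp (Ideal.subset_span (by simp))
    exact mem_of_constantCoeff_eq_zero U hU 𝔭 hup hvp x (constantCoeff_eq_zero_of_mem_vertex U hU 𝔪 hu hv x hx)
  obtain ⟨N, hN⟩ := Ideal.exists_pow_le_of_le_radical_of_fg hrad (IsNoetherian.noetherian 𝔪)
  exact ⟨N, hN.trans hI⟩

include hU in
/-- **`ca(U_𝔪)` is `𝔪U_𝔪`-primary at the vertex** (for any localisation `S` of `U` at the vertex `𝔪`):
`(𝔪S)ᴺ ⊆ ca³(U)·S ⊆ ca³(S) ⊆ ca(S)`. [OURS · cell decomp-res] -/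
theorem exists_maximalIdeal_pow_le_cohomologyAnnihilator_atVertex (hq : q.Coprime n) (𝔪 : Ideal U) [𝔪.IsMaximal]
    (hu : (⟨(X 0 : MvPolynomial (Fin 2) k) ^ n, X_pow_mem U hU 0⟩ : U) ∈ 𝔪)
    (hv : (⟨(X 1 : MvPolynomial (Fin 2) k) ^ n, X_pow_mem U hU 1⟩ : U) ∈ 𝔪)
    (S : Type u) [CommRing S] [Algebra U S] [IsLocalization.AtPrime S 𝔪] [IsLocalRing S] :
    ∃ N : ℕ, maximalIdeal S ^ N ≤ cohomologyAnnihilator S := by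
  haveI : IsNoetherianRing U := isNoetherianRing_degreeZero (k := k) (n := n) q U hU
  obtain ⟨N, hN⟩ := maximalIdeal_pow_le_caAt_three_vertex U hU hq 𝔪 hu hv
  refine ⟨N, ?_⟩
  rw [← IsLocalization.AtPrime.map_eq_maximalIdeal 𝔪 S, ← Ideal.map_pow]
  exact (Ideal.map_mono hN).trans ((map_cohomologyAnnihilatorOfDegree_le_of_isLocalization 𝔪.primeCompl S 3).trans
    (cohomologyAnnihilatorOfDegree_le 3))

include hU in
/-- **Levelled `Sat₄` on any localisation `S` of `U` at the vertex**: `caᵐ(S) = ca⁴(U)·S` for every `m ≥ 4`, and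
`ca(S) ⊆ ca⁴(S)`. [OURS · cell decomp-res] -/
theorem cohomologyAnnihilator_le_caAt_four_atVertex (hq : q.Coprime n) (𝔪 : Ideal U) [𝔪.IsMaximal]
    (hu : (⟨(X 0 : MvPolynomial (Fin 2) k) ^ n, X_pow_mem U hU 0⟩ : U) ∈ 𝔪)
    (hv : (⟨(X 1 : MvPolynomial (Fin 2) k) ^ n, X_pow_mem U hU 1⟩ : U) ∈ 𝔪)
    (S : Type u) [CommRing S] [Algebra U S] [IsLocalization.AtPrime S 𝔪] [IsNoetherianRing S] :
    (∀ m : ℕ, 4 ≤ m → cohomologyAnnihilatorOfDegree S m = (cohomologyAnnihilatorOfDegree U 4).map (algebraMap U S)) ∧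
      cohomologyAnnihilator S ≤ cohomologyAnnihilatorOfDegree S 4 := by
  haveI : IsNoetherianRing U := isNoetherianRing_degreeZero (k := k) (n := n) q U hU
  have hoff : ∀ (𝔫 : Ideal U) [𝔫.IsMaximal], 𝔫 ≠ 𝔪 →
      cohomologyAnnihilatorOfDegree (Localization.AtPrime 𝔫) 4 = ⊤ := fun 𝔫 _ hne =>
    PersistenceSurfaceSaturationIsolatedLocalization.caAt_atPrime_eq_top_of_isRegularLocalRing_off 𝔪 (d := 2)
      (ringKrullDim_degreeZero U hU).le
      (fun 𝔫' _ hne' => isRegularLocalRing_atPrime_of_ne_vertex U hU hq 𝔪 hu hv 𝔫' hne') (by norm_num) 𝔫 hne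
  have hmapS : ∀ m : ℕ, 4 ≤ m →
      cohomologyAnnihilatorOfDegree S m = (cohomologyAnnihilatorOfDegree U 4).map (algebraMap U S) := by
    intro m hm
    have hoffm : ∀ (𝔫 : Ideal U) [𝔫.IsMaximal], 𝔫 ≠ 𝔪 →
        cohomologyAnnihilatorOfDegree (Localization.AtPrime 𝔫) m = ⊤ := fun 𝔫 _ h =>
      top_le_iff.mp ((hoff 𝔫 h).symm.le.trans (cohomologyAnnihilatorOfDegree_mono hm))
    rw [PersistenceSurfaceSaturationIsolatedLocalization.cohomologyAnnihilatorOfDegree_eq_map_of_isLocalization 𝔪 S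
        hoffm, cohomologyAnnihilatorOfDegree_eq_cyclicQuotient_charFree U hU hq hm,
      ← cohomologyAnnihilatorOfDegree_eq_cyclicQuotient_charFree U hU hq le_rfl]
  refine ⟨hmapS, ?_⟩
  obtain ⟨N, hN⟩ := exists_cohomologyAnnihilator_eq_of_isNoetherianRing (R := S)
  rw [hN]
  refine (cohomologyAnnihilatorOfDegree_mono (le_max_left N 4)).trans ?_
  rw [hmapS (max N 4) (le_max_right N 4), ← hmapS 4 le_rfl]

/-! ## `Sat_{4+d}` at every ring analytically isomorphic to the vertex -/

include hU in
/-- **`ca(T) ⊆ ca^{4+d}(T)` at every noetherian local `T` whose COMPLETION is that of the vertex.**  `𝔪 ∋ uⁿ, vⁿ` the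
vertex of `U = k[u,v]^{(n;1,q)}` (`gcd(q,n) = 1`, `k` any field), `S` any localisation of `U` at `𝔪`,
`dim S = dim T = d`, both completions isolated singularities, `e : T̂ ≃+* Ŝ` ⇒ `ca(T) ⊆ ca^{4+d}(T)`.  For surface
stages (`d = 2`) this is `Sat₆(T)` — the stub's `Sat₄` at such stages is NOT reached by this route (BHST's shift).
[OURS · cell decomp-res] -/
theorem cohomologyAnnihilator_le_caAt_of_ringEquiv_completion_vertex (hq : q.Coprime n) (𝔪 : Ideal U)
    [𝔪.IsMaximal] (hu : (⟨(X 0 : MvPolynomial (Fin 2) k) ^ n, X_pow_mem U hU 0⟩ : U) ∈ 𝔪)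
    (hv : (⟨(X 1 : MvPolynomial (Fin 2) k) ^ n, X_pow_mem U hU 1⟩ : U) ∈ 𝔪)
    (S : Type u) [CommRing S] [Algebra U S] [IsLocalization.AtPrime S 𝔪] [IsNoetherianRing S] [IsLocalRing S]
    {T : Type u} [CommRing T] [IsNoetherianRing T] [IsLocalRing T] {d : ℕ}
    (hdS : ringKrullDim S = d) (hdT : ringKrullDim T = d)
    (hisoS : IsIsolatedSingularity (AdicCompletion (maximalIdeal S) S))
    (hisoT : IsIsolatedSingularity (AdicCompletion (maximalIdeal T) T))
    (e : AdicCompletion (maximalIdeal T) T ≃+* AdicCompletion (maximalIdeal S) S) :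
    cohomologyAnnihilator T ≤ cohomologyAnnihilatorOfDegree T (4 + d) :=
  cohomologyAnnihilator_le_caAt_add_of_ringEquiv_completion hdS hdT hisoS hisoT e
    (exists_maximalIdeal_pow_le_cohomologyAnnihilator_atVertex U hU hq 𝔪 hu hv S)
    (cohomologyAnnihilator_le_caAt_four_atVertex U hU hq 𝔪 hu hv S).2

/-! ## The level-exact door: what a COMPLETE toric theorem would give -/

/-- **Level-exact transport through the completion, given LEVELLED saturation upstairs.**  `T` noetherian local of
Krull dimension `d` with `T̂` an isolated singularity, `S'` any commutative ring with `e : T̂ ≃+* S'` and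
`caⁿ(S') ⊆ caᴺ(S')` for all `n ≥ N` ⇒ `ca(T) ⊆ caᴺ(T)` — NO shift: `x ∈ caⁿ(T) ↦ x̂ ∈ caⁿ⁺ᵈ(T̂) ≅ caⁿ⁺ᵈ(S') ⊆
caᴺ(S') ≅ caᴺ(T̂)`, `caᴺ(T̂) ∩ T ⊆ caᴺ(T)`.  This is the door through which a levelled `Sat₄` theorem for the COMPLETE
cyclic quotient `(U_𝔪)^` (not in the tree: it needs second syzygies over `(U_𝔪)^` to be retracts of base changes of
second syzygies over `U_𝔪` — punctured-free retract, reflexivity of second syzygies, `Hom` base change) would give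
`Sat₄` at every analytically-toric stage. [cite: BahlekehHakimianSalarianTakahashi2015, Thm. 4.5] -/
theorem cohomologyAnnihilator_le_caAt_of_levelled_of_ringEquiv_completion {T S' : Type u} [CommRing T]
    [CommRing S'] [IsNoetherianRing T] [IsLocalRing T] {d N : ℕ} (hdT : ringKrullDim T = d)
    (hisoT : IsIsolatedSingularity (AdicCompletion (maximalIdeal T) T))
    (e : AdicCompletion (maximalIdeal T) T ≃+* S')
    (hsat : ∀ n : ℕ, N ≤ n → cohomologyAnnihilatorOfDegree S' n ≤ cohomologyAnnihilatorOfDegree S' N) :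
    cohomologyAnnihilator T ≤ cohomologyAnnihilatorOfDegree T N := by
  intro x hx
  obtain ⟨n, hn⟩ := mem_cohomologyAnnihilator_iff.mp hx
  have h1 := le_caCompletion_comap_holds T d hdT hisoT n hn
  rw [Ideal.mem_comap] at h1
  have h2 : e (algebraMap T (AdicCompletion (maximalIdeal T) T) x) ∈ cohomologyAnnihilatorOfDegree S' N :=
    hsat (n + d + N) (by omega)
      (cohomologyAnnihilatorOfDegree_mono (by omega) (ringEquiv_apply_mem_cohomologyAnnihilatorOfDegree e h1))
  have h3 : algebraMap T (AdicCompletion (maximalIdeal T) T) x ∈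
      cohomologyAnnihilatorOfDegree (AdicCompletion (maximalIdeal T) T) N := by
    have h := ringEquiv_apply_mem_cohomologyAnnihilatorOfDegree e.symm h2
    rwa [RingEquiv.symm_apply_apply] at h
  exact caCompletion_comap_le_holds T N (Ideal.mem_comap.mpr h3)

end Summit.ResolutionOfSingularities.ResolutionOfSingularities.Theorems.HomologicalConductor.PersistenceSurfaceSaturationCommonCompletion

end
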